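import Summits.AtomisticToContinuum.Crystallization.Theorems.GappedShellCensusCleanLimitsHaveWindowsLayeredFirstLayer
import Summits.AtomisticToContinuum.Crystallization.Theorems.GappedShellCensusCleanLimitsHaveWindowsLayeredStepUp
import Summits.AtomisticToContinuum.Crystallization.Theorems.GappedShellCensusCleanLimitsHaveWindowsLayeredStepDown

/-!
# `GappedShellCensus.CleanLimitsHaveWindows` (stmt-AtomisticToContinuum-15932), line `Sketch`:
# stub `stub_layeredOfExactShells` (T3a-ii) — exact shells everywhere ⇒ an exactly layered set

Registered stub of the lead skeleton (`Cruxes/CleanLimitsHaveWindows/Lines/Sketch.lean`), assembled from the landed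
chain: one complete triangular layer (`stub_firstLayer`, file `…LayeredFirstLayer`), then complete layers upwards and
downwards with empty slabs in between (`stub_layerStepUp`, `stub_layerStepDown`, files `…LayeredStepUp/StepDown`, from
`stub_layerCaps`), iterated along `ℤ`; the union of the layers covers `Z` and is read off as
`v + A(S(a′, s, z))` with a Hägg word `s` and strictly increasing heights `z`. [folklore]
-/

noncomputable section

namespace Summit.AtomisticToContinuum.Crystallization.Theorems.CleanHull

open Literature.MathematicalPhysics.StatisticalMechanics Literature.Geometry.DiscreteGeometry

/-- **Stub T3a-ii (exactly layered shells everywhere ⇒ exactly layered set).** [folklore] -/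
theorem stub_layeredOfExactShells (Z : Set (EuclideanSpace ℝ (Fin 3))) (a : ℝ) (ha : 0 < a) (hne : Z.Nonempty)
    (hclean : ∀ y ∈ Z, ({w ∈ Z | w ≠ y ∧ dist y w ≤ a * (1 + 1 / 50)}.ncard = 12 ∧
        ∀ w ∈ Z, w ≠ y → a * (1 - 1 / 50) ≤ dist y w ∧
          (dist y w ≤ a * (1 + 1 / 50) ∨ a * (63 / 50) ≤ dist y w)) ∧
      ∃ T : Finset (EuclideanSpace ℝ (Fin 3)), (↑T : Set (EuclideanSpace ℝ (Fin 3))) =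
          (fun w => a⁻¹ • (w - y)) '' {w ∈ Z | w ≠ y ∧ dist y w ≤ a * (1 + 1 / 50)} ∧
        (ShellCloseTo (1 / 5) T fccKissingPattern ∨ ShellCloseTo (1 / 5) T hcpKissingPattern))
    (hexact : ∀ p ∈ Z, ∃ (a' hp' hm' : ℝ) (A : EuclideanSpace ℝ (Fin 3) →ₗᵢ[ℝ] EuclideanSpace ℝ (Fin 3)),
      0 < a' ∧ 0 < hp' ∧ 0 < hm' ∧
      ((bondShell a Z p = Set.range fun k : Fin 12 => p + A (slotC a' hp' hm' k)) ∨
       (bondShell a Z p = Set.range fun k : Fin 12 => p + A (slotH a' hp' hm' k)))) :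
    ∃ (a' : ℝ) (A : EuclideanSpace ℝ (Fin 3) →ₗᵢ[ℝ] EuclideanSpace ℝ (Fin 3)) (s : ℤ → ℤ) (z : ℤ → ℝ)
      (v : EuclideanSpace ℝ (Fin 3)), 0 < a' ∧ IsHaggSeq s ∧ (∀ m : ℤ, 0 < z (m + 1) - z m) ∧
      Z = (fun p => p + v) '' {p | ∃ m i j : ℤ, p = A (((i : ℝ) • triangularVec₁ a') +
        ((j : ℝ) • triangularVec₂ a') + ((haggLabel s m : ℝ) • barlowOffset a') + (z m • layerNormal 1))} := by
  classical
  have hgap : ∀ y ∈ Z, ∀ w ∈ Z, w ≠ y → a * (1 - 1 / 50) ≤ dist y w ∧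
      (dist y w ≤ a * (1 + 1 / 50) ∨ a * (63 / 50) ≤ dist y w) :=
    fun y hy w hw hwy => (hclean y hy).1.2 w hw hwy
  obtain ⟨p₀, -, a', A, hlo, hhi, hL0⟩ := stub_firstLayer Z a ha hne hgap hexact
  -- layer points and heights
  let pt : ℤ → ℝ → ℤ → ℤ → EuclideanSpace ℝ (Fin 3) := fun L z i j =>
    A (((i : ℝ) • triangularVec₁ a') + ((j : ℝ) • triangularVec₂ a') + ((L : ℝ) • barlowOffset a') +
      (z • layerNormal 1)) + p₀
  let ht : EuclideanSpace ℝ (Fin 3) → ℝ := fun x => inner ℝ (x - p₀) (A (layerNormal 1))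
  -- one step up / down, as functions on complete layers
  have hup : ∀ q : {Lz : ℤ × ℝ // ∀ i j : ℤ, pt Lz.1 Lz.2 i j ∈ Z},
      ∃ q' : {Lz : ℤ × ℝ // ∀ i j : ℤ, pt Lz.1 Lz.2 i j ∈ Z},
        (q'.1.1 - q.1.1 = 1 ∨ q'.1.1 - q.1.1 = -1) ∧ 39 / 50 * a ≤ q'.1.2 - q.1.2 ∧
        ∀ x ∈ Z, q.1.2 ≤ ht x → ht x < q'.1.2 → ∃ i j : ℤ, x = pt q.1.1 q.1.2 i j := by
    rintro ⟨⟨L, z⟩, hLz⟩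
    obtain ⟨ε, h, hε, hlo', -, hnext, hexa⟩ := stub_layerStepUp Z a ha hgap hexact p₀ a' A hlo hhi L z hLz
    refine ⟨⟨(L + ε, z + h), hnext⟩, ?_, ?_, ?_⟩
    · simpa using hε
    · show 39 / 50 * a ≤ z + h - z
      linarith
    · intro x hx h1 h2
      exact hexa x hx h1 h2
  have hdown : ∀ q : {Lz : ℤ × ℝ // ∀ i j : ℤ, pt Lz.1 Lz.2 i j ∈ Z},
      ∃ q' : {Lz : ℤ × ℝ // ∀ i j : ℤ, pt Lz.1 Lz.2 i j ∈ Z},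
        (q.1.1 - q'.1.1 = 1 ∨ q.1.1 - q'.1.1 = -1) ∧ 39 / 50 * a ≤ q.1.2 - q'.1.2 ∧
        ∀ x ∈ Z, q'.1.2 ≤ ht x → ht x < q.1.2 → ∃ i j : ℤ, x = pt q'.1.1 q'.1.2 i j := by
    rintro ⟨⟨L, z⟩, hLz⟩
    obtain ⟨ε, h, hε, hlo', -, hnext, hexa⟩ := stub_layerStepDown Z a ha hgap hexact p₀ a' A hlo hhi L z hLz
    refine ⟨⟨(L + ε, z - h), hnext⟩, ?_, ?_, ?_⟩
    · rcases hε with rfl | rfl <;> simp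
    · show 39 / 50 * a ≤ z - (z - h)
      linarith
    · intro x hx h1 h2
      exact hexa x hx h1 h2
  choose F hF1 hF2 hF3 using hup
  choose G hG1 hG2 hG3 using hdown
  have h00 : ∀ i j : ℤ, pt 0 0 i j ∈ Z := by
    intro i j
    have := hL0 i j
    simpa [pt] using this
  let q0 : {Lz : ℤ × ℝ // ∀ i j : ℤ, pt Lz.1 Lz.2 i j ∈ Z} := ⟨(0, 0), h00⟩
  let U : ℕ → {Lz : ℤ × ℝ // ∀ i j : ℤ, pt Lz.1 Lz.2 i j ∈ Z} := fun n => F^[n] q0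
  let D : ℕ → {Lz : ℤ × ℝ // ∀ i j : ℤ, pt Lz.1 Lz.2 i j ∈ Z} := fun n => G^[n] q0
  let LZ : ℤ → ℤ × ℝ := fun m => Int.rec (fun n => (U n).1) (fun n => (D (n + 1)).1) m
  have hU : ∀ n : ℕ, U (n + 1) = F (U n) := fun n => Function.iterate_succ_apply' F n q0
  have hD : ∀ n : ℕ, D (n + 1) = G (D n) := fun n => Function.iterate_succ_apply' G n q0
  have hLZ_nat : ∀ n : ℕ, LZ (n : ℤ) = (U n).1 := fun n => rfl
  have hLZ_neg : ∀ n : ℕ, LZ (Int.negSucc n) = (D (n + 1)).1 := fun n => rfl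
  -- every layer lies in `Z`
  have hmem : ∀ m i j : ℤ, pt (LZ m).1 (LZ m).2 i j ∈ Z := by
    intro m i j
    cases m with
    | ofNat n => exact (U n).2 i j
    | negSucc n => exact (D (n + 1)).2 i j
  -- consecutive layers
  have hstep : ∀ m : ℤ, ((LZ (m + 1)).1 - (LZ m).1 = 1 ∨ (LZ (m + 1)).1 - (LZ m).1 = -1) ∧
      39 / 50 * a ≤ (LZ (m + 1)).2 - (LZ m).2 ∧
      ∀ x ∈ Z, (LZ m).2 ≤ ht x → ht x < (LZ (m + 1)).2 → ∃ i j : ℤ, x = pt (LZ m).1 (LZ m).2 i j := by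
    intro m
    cases m with
    | ofNat n =>
      have e0 : LZ (Int.ofNat n) = (U n).1 := rfl
      have e1 : LZ (Int.ofNat n + 1) = (F (U n)).1 := by
        rw [← hU n]; rfl
      rw [e0, e1]
      exact ⟨hF1 (U n), hF2 (U n), hF3 (U n)⟩
    | negSucc n =>
      cases n with
      | zero =>
        have e0 : LZ (Int.negSucc 0) = (G q0).1 := by
          rw [hLZ_neg 0, hD 0]; rfl
        have e1 : LZ (Int.negSucc 0 + 1) = q0.1 := rfl
        rw [e0, e1]
        exact ⟨hG1 q0, hG2 q0, hG3 q0⟩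
      | succ k =>
        have e0 : LZ (Int.negSucc (k + 1)) = (G (D (k + 1))).1 := by
          rw [hLZ_neg (k + 1), hD (k + 1)]
        have e1 : LZ (Int.negSucc (k + 1) + 1) = (D (k + 1)).1 := by
          rw [show Int.negSucc (k + 1) + 1 = Int.negSucc k by rfl, hLZ_neg k]
        rw [e0, e1]
        exact ⟨hG1 (D (k + 1)), hG2 (D (k + 1)), hG3 (D (k + 1))⟩
  -- the Hägg word, the heights, the labels
  let s : ℤ → ℤ := fun m => (LZ (m + 1)).1 - (LZ m).1
  let zf : ℤ → ℝ := fun m => (LZ m).2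
  have hHagg : IsHaggSeq s := fun m => (hstep m).1
  have hc : 0 < 39 / 50 * a := by positivity
  have hzpos : ∀ m : ℤ, 0 < zf (m + 1) - zf m := fun m => lt_of_lt_of_le hc (hstep m).2.1
  have hlabel : ∀ m : ℤ, haggLabel s m = (LZ m).1 := by
    intro m
    induction m using Int.induction_on with
    | zero => rw [haggLabel_zero]; rfl
    | succ n ih =>
      rw [haggLabel_succ, ih]
      show (LZ (n : ℤ)).1 + ((LZ ((n : ℤ) + 1)).1 - (LZ (n : ℤ)).1) = (LZ ((n : ℤ) + 1)).1
      omega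
    | pred n ih =>
      have h1 := haggLabel_succ s (-(n : ℤ) - 1)
      rw [show -(n : ℤ) - 1 + 1 = -n by ring, ih] at h1
      have : s (-(n : ℤ) - 1) = (LZ (-n)).1 - (LZ (-(n : ℤ) - 1)).1 := by
        show (LZ (-(n : ℤ) - 1 + 1)).1 - (LZ (-(n : ℤ) - 1)).1 = _
        rw [show -(n : ℤ) - 1 + 1 = -n by ring]
      omega
  -- heights grow at least linearly
  have hgrow : ∀ (m : ℤ) (k : ℕ), zf m + 39 / 50 * a * k ≤ zf (m + k) := by
    intro m k
    induction k with
    | zero => simp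
    | succ k ih =>
      have := (hstep (m + k)).2.1
      have e : m + ((k + 1 : ℕ) : ℤ) = m + k + 1 := by push_cast; ring
      rw [e]
      push_cast
      linarith
  -- every point of `Z` lies on a layer
  have hcover : ∀ x ∈ Z, ∃ m i j : ℤ, x = pt (LZ m).1 (LZ m).2 i j := by
    intro x hx
    have hbdd : ∃ b : ℤ, ∀ m : ℤ, zf m ≤ ht x → m ≤ b := by
      obtain ⟨N, hN⟩ := exists_nat_gt ((ht x - zf 0) / (39 / 50 * a))
      refine ⟨N, fun m hm => ?_⟩
      by_contra hlt
      push Not at hlt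
      obtain ⟨k, rfl⟩ := Int.eq_ofNat_of_zero_le (show (0 : ℤ) ≤ m by omega)
      have hg := hgrow 0 k
      rw [zero_add] at hg
      have hkN : (N : ℝ) < k := by exact_mod_cast (show (N : ℤ) < k from hlt)
      have h2 : (ht x - zf 0) / (39 / 50 * a) < k := hN.trans hkN
      rw [div_lt_iff₀ hc] at h2
      linarith
    have hinh : ∃ m : ℤ, zf m ≤ ht x := by
      obtain ⟨N, hN⟩ := exists_nat_gt ((zf 0 - ht x) / (39 / 50 * a))
      refine ⟨-(N : ℤ), ?_⟩
      have hg := hgrow (-(N : ℤ)) N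
      rw [show -(N : ℤ) + N = 0 by ring] at hg
      rw [div_lt_iff₀ hc] at hN
      linarith
    obtain ⟨m, hm1, hm2⟩ := Int.exists_greatest_of_bdd hbdd hinh
    have hlt : ht x < zf (m + 1) := by
      by_contra hle
      push Not at hle
      have := hm2 (m + 1) hle
      omega
    obtain ⟨i, j, hxij⟩ := (hstep m).2.2 x hx hm1 hlt
    exact ⟨m, i, j, hxij⟩
  -- read off
  have ha' : 0 < a' := lt_of_lt_of_le (by positivity) hlo
  refine ⟨a', A, s, zf, p₀, ha', hHagg, hzpos, ?_⟩
  ext x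
  simp only [Set.mem_image, Set.mem_setOf_eq]
  constructor
  · intro hx
    obtain ⟨m, i, j, rfl⟩ := hcover x hx
    exact ⟨_, ⟨m, i, j, rfl⟩, by rw [hlabel m]⟩
  · rintro ⟨_, ⟨m, i, j, rfl⟩, rfl⟩
    rw [hlabel m]
    exact hmem m i j

end Summit.AtomisticToContinuum.Crystallization.Theorems.CleanHull

end
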